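import Mathlib.Analysis.SpecialFunctions.Pow.Real
import Literature.Computability.MetaComplexity.MagnificationFrontiers
import Literature.Computability.MetaComplexity.FormulaModelsAE
import HarnessLib

/-!
# CHOPRS frontier items B4 / C4 over the almost-everywhere leaf-size formula class
# (non-vacuous re-rendering of `MagnificationFrontiers.lean`)

Citation header. L. Chen, S. Hirahara, I. C. Oliveira, J. Pich, N. Rajgopal, R. Santhanam, *Beyond
natural proofs: hardness magnification and locality*, ITCS 2020 / J. ACM 69(4) (2022),
arXiv:1911.08297 [bib: `arXiv191108297`], §1.1 (verbatim from the held text):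

* **B4.** *"MCSP[2^{n^{1/3}}, 2^{n^{2/3}}] ∉ Formula[N^{1.99}] ([HS17]; see also [OPS19])."*
* **C4.** *"MCSP[2^{n^{1/2}}/10n, 2^{n^{1/2}}] ∉ Formula[N^{1.99}] ([HS17]; see also [OPS19])."*
* §1.1, note B: *"Formula-XOR[s] refers to the class of Boolean formulas over the De Morgan basis
  with at most s leaves, where each leaf is an XOR of arbitrary arity over the inputs"* — so
  `Formula[s]` is De Morgan formulas with at most `s` leaves; `MCSP[s, t]` is the promise problem
  with YES = truth tables (length `N = 2ⁿ`) of circuit complexity `≤ s`, NO = circuit complexity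
  `≥ t` (§1.1, note A, "cf. [OPS19]").

Why this file. `MagnificationFrontiers.lean` renders B4/C4 over the tree's every-length class
`FORMULA s`, which is EMPTY (`FORMULA_eq_empty`, `MagnificationFrontiersProofs.lean`: a fan-in-2
formula has an odd number of gates, so no family meets the bound at two consecutive lengths), making
`chop_frontierB4/C4` provable with no lower-bound content (census audit F1). Here the same two
printed facts are rendered over `FORMULAae s` (`FormulaModelsAE.lean`): De Morgan formulas, size =
number of LEAVES (`Circuit.leafSize`, exactly CHOPRS's measure), bound imposed at all sufficiently
large lengths — a NON-EMPTY class (`headLang_mem_frontierFormulaClassAE`).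

Faithfulness. `Q ∉ promiseLift (FORMULAae S)` says: no sequence of De Morgan formulas with
eventually `≤ S N` leaves solves the promise problem at every length; equivalently, for infinitely
many lengths `N` no formula with `≤ S N` leaves solves the length-`N` instances. This is the
(weakest) asymptotic reading of "`∉ Formula[N^{1.99}]`" and is implied by what [HS17]/[OPS19,
Thm. 1.5 and §5.1] prove: for every sufficiently large `n`, no `U₂`/De Morgan formula of `N^{1.99}`
leaves solves the length-`N = 2ⁿ` slice. Thresholds are rounded in the safe directions for a KNOWN
bound (as in `MagnificationFrontiers.lean`): YES bound UP (`⌈·⌉`), NO bound DOWN (`⌊·⌋`), leaf bound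
DOWN (`⌊N^{1.99}⌋`, exact for an integer leaf count) — a promise problem with more instances and a
smaller class make the asserted lower bound weaker. Circuit complexity inside `MCSP[s,t]` is the
tree's `circuitSizeOver B2` (fan-in-two circuits over `B₂`, gates), OPS19's convention (§1.2).
Nothing is proved here; users take `(h : chop_frontierB4_ae)`.
-/

noncomputable section

open Literature.Computability.Complexity

namespace Literature.Computability.MetaComplexity

/-- The a.e. formula-size class of the frontiers: De Morgan formulas with, at all sufficiently
large lengths, at most `⌊N^{1.99}⌋` leaves. [cite: arXiv191108297, §1.1 (Formula[N^{1.99}])] -/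
def frontierFormulaClassAE : Set (Language Bool) :=
  FORMULAae fun N => ⌊(N : ℝ) ^ (1.99 : ℝ)⌋₊

/-- NAMED FACT (**CHOPRS, §1.1, HM Frontier C, item C4**, after Hirahara–Santhanam 2017 and
Oliveira–Pich–Santhanam 2019), a.e. leaf-size rendering: the promise problem
`MCSP[2^{√n}/10n, 2^{√n}]` (`N = 2ⁿ`) is not solved by De Morgan formulas of leaf-size `N^{1.99}`:
no language in `frontierFormulaClassAE` separates its YES from its NO instances. Thresholds rounded
in the safe directions (module doc). Users take `(h : chop_frontierC4_ae)`.
[cite: arXiv191108297, §1.1 (C4)] -/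
def chop_frontierC4_ae : Prop :=
  gapMCSP (fun n => ⌈(2 : ℝ) ^ Real.sqrt n / (10 * n)⌉₊) (fun n => ⌊(2 : ℝ) ^ Real.sqrt n⌋₊) ∉
    promiseLift frontierFormulaClassAE

/-- NAMED FACT (**CHOPRS, §1.1, HM Frontier B, item B4**, after HS17 / OPS19), a.e. leaf-size
rendering: the promise problem `MCSP[2^{n^{1/3}}, 2^{n^{2/3}}]` is not solved by De Morgan formulas
of leaf-size `N^{1.99}` (no separating language in `frontierFormulaClassAE`).
Users take `(h : chop_frontierB4_ae)`. [cite: arXiv191108297, §1.1 (B4)] -/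
def chop_frontierB4_ae : Prop :=
  gapMCSP (fun n => ⌈(2 : ℝ) ^ ((n : ℝ) ^ (1 / 3 : ℝ))⌉₊)
      (fun n => ⌊(2 : ℝ) ^ ((n : ℝ) ^ (2 / 3 : ℝ))⌋₊) ∉
    promiseLift frontierFormulaClassAE

/-! ### API -/

/-- Non-vacuity: the a.e. frontier class is inhabited (the language "first bit is `1`" has
one-leaf formulas, and `1 ≤ ⌊N^{1.99}⌋` for `N ≥ 1`) — in contrast with the every-length class
`frontierFormulaClass = ∅`. [folklore] -/
theorem headLang_mem_frontierFormulaClassAE : headLang ∈ frontierFormulaClassAE := by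
  refine headLang_mem_FORMULAae ⟨1, fun N hN => ?_⟩
  have h1 : (1 : ℝ) ≤ (N : ℝ) ^ (1.99 : ℝ) := Real.one_le_rpow (by exact_mod_cast hN) (by norm_num)
  exact (Nat.le_floor_iff (by positivity)).mpr (by exact_mod_cast h1)

/-- Consequence shape: under C4 (a.e.), any language separating the C4 promise problem lies
outside the a.e. frontier formula class, i.e. every De Morgan formula sequence deciding it has more
than `N^{1.99}` leaves at infinitely many lengths. [cite: arXiv191108297, §1.1 (C4)] -/
theorem not_mem_frontierFormulaClassAE_of_separates (h : chop_frontierC4_ae) {L : Language Bool}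
    (hyes : (gapMCSP (fun n => ⌈(2 : ℝ) ^ Real.sqrt n / (10 * n)⌉₊)
      (fun n => ⌊(2 : ℝ) ^ Real.sqrt n⌋₊)).yes ≤ L)
    (hno : (gapMCSP (fun n => ⌈(2 : ℝ) ^ Real.sqrt n / (10 * n)⌉₊)
      (fun n => ⌊(2 : ℝ) ^ Real.sqrt n⌋₊)).no ≤ Lᶜ) :
    L ∉ frontierFormulaClassAE := fun hL =>
  h ⟨L, hL, hyes, hno⟩

end Literature.Computability.MetaComplexity
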